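import Summits.SmoothPoincare4.SmoothPoincare4.Theses.SblfDescent

/-!
# `StepTwo` — negative-side support: refutation cost (crux stmt-SmoothPoincare4-18529)

Crux `SblfDescent.StepTwo` (the genus-2 rung: every smooth homotopy 4-sphere admitting a simplified
broken Lefschetz fibration of lower genus 1 admits one of lower genus 0), cdisprove seat.

Write `HAS M h` for the route's inline SBLF predicate (spelled out verbatim below, `h = 0`).  The only
input that is not a route item is the hypothesis `hADK`: *every 4-manifold diffeomorphic to `S⁴`
carries a genus-1 simplified broken Lefschetz fibration* — the Auroux–Donaldson–Katzarkov fibration of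
`S⁴` (Baykur–Kamada, arXiv:1010.5814, Fig. "genus one SBLFs") transported along the diffeomorphism;
a published fact, kept as an explicit hypothesis until it is formalised.

* `not_smoothPoincare4_of_not_stepTwo`: modulo `hADK` a refutation of the crux is a refutation of
  the summit — any counterexample is an exotic 4-sphere (of broken genus 2).  No finite, degenerate
  or junk model can kill the crux.
* `strongest_iff_smoothPoincare4`: deleting the WHOLE genus-2 hypothesis gives "every smooth
  homotopy 4-sphere has a genus-1 SBLF", which is EQUIVALENT to the summit modulo `hADK` and the
  route's support `RungOne` (Hayano / Baykur–Kamada).  Every "`StepTwo` minus a conjunct of the SBLF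
  datum" (achiral Lefschetz points, several fold circles, immersed round image, disconnected fibres,
  Lefschetz points on either side, no genus bound …) sits between the crux and this variant
  (`not_strongest_of_not_stepTwo`), so the conjuncts are load-bearing for the proof METHOD only,
  never for the truth value modulo the summit.  The genuinely load-bearing hypothesis is `M ≃ₕ S⁴`
  (`ℂℙ²` has broken genus 2: Baykur, arXiv:1205.5439, Thm 18).
-/

noncomputable section

-- the prescribed namespace `Summit.<P>.<Sub>.…` duplicates `SmoothPoincare4` (P = Sub)
set_option linter.dupNamespace false

open scoped Manifold ContDiff Topology ContinuousMap

namespace Summit.SmoothPoincare4.SmoothPoincare4.Theorems.StepTwo.Negative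

open Summit.SmoothPoincare4.SmoothPoincare4.Theses.SblfDescent

/-- **Refutation cost of the crux.**  Modulo `hADK` (genus-1 SBLF on every standard `S⁴`),
`¬ StepTwo → ¬ SmoothPoincare4`: the summit makes every homotopy 4-sphere standard, hence of lower
genus 0, uniformly in the genus-2 datum; so killing the rung kills the summit. [folklore] -/
theorem not_smoothPoincare4_of_not_stepTwo
    (hADK : ∀ (M : Type) [TopologicalSpace M] [T2Space M] [SecondCountableTopology M]
      [ChartedSpace (EuclideanSpace ℝ (Fin 4)) M] [IsManifold (𝓡 4) ∞ M],
      Nonempty (M ≃ₘ⟮𝓡 4, 𝓡 4⟯ (Metric.sphere (0 : EuclideanSpace ℝ (Fin 5)) 1)) →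
      (∃ (o : Literature.Topology.FourManifolds.SmoothOrientation (𝓡 4) M) (f : M → (Metric.sphere (0 : EuclideanSpace ℝ (Fin 3)) 1)) (L : Finset M), let R : M → Prop := fun q => Function.Surjective (mfderiv (𝓡 4) (𝓡 2) f q); let G : (Metric.sphere (0 : EuclideanSpace ℝ (Fin 3)) 1) → ℕ → Prop := fun y n => Nonempty ((Fin (2 * n) → ℤ) ≃ₗ[ℤ] Literature.AlgebraicTopology.SingularHomology.singularHomology ℤ ℤ ↥(f ⁻¹' {y}) 1); ContMDiff (𝓡 4) (𝓡 2) ((⊤ : ℕ∞) : WithTop ℕ∞) f ∧ Function.Surjective f ∧ (∀ p ∈ L, Literature.Topology.FourManifolds.IsLefschetzCriticalPoint (𝓡 4) (𝓡 2) o f p true) ∧ (∀ p : M, ¬ R p → p ∉ L → ∃ (φ : OpenPartialHomeomorph M (EuclideanSpace ℝ (Fin 4))) (ψ : OpenPartialHomeomorph (Metric.sphere (0 : EuclideanSpace ℝ (Fin 3)) 1) (EuclideanSpace ℝ (Fin 2))), p ∈ φ.source ∧ φ p = 0 ∧ Set.MapsTo f φ.source ψ.source ∧ ContMDiffOn (𝓡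 4) (𝓡 4) ((⊤ : ℕ∞) : WithTop ℕ∞) φ φ.source ∧ ContMDiffOn (𝓡 4) (𝓡 4) ((⊤ : ℕ∞) : WithTop ℕ∞) φ.symm φ.target ∧ ContMDiffOn (𝓡 2) (𝓡 2) ((⊤ : ℕ∞) : WithTop ℕ∞) ψ ψ.source ∧ ContMDiffOn (𝓡 2) (𝓡 2) ((⊤ : ℕ∞) : WithTop ℕ∞) ψ.symm ψ.target ∧ ∀ q ∈ φ.source, (ψ (f q)) 0 = (φ q) 0 ∧ (ψ (f q)) 1 = (φ q) 1 ^ 2 + (φ q) 2 ^ 2 - (φ q) 3 ^ 2) ∧ IsConnected ({p : M | ¬ R p} \ (↑L : Set M)) ∧ Set.InjOn f {p : M | ¬ R p} ∧ (∀ y, (∀ q, f q = y → R q) → IsConnected (f ⁻¹' {y}) ∧ (G y (0 + 1) ∨ G y (0))) ∧ (∃ y, (∀ q, f q = y → R q) ∧ G y (0 + 1)) ∧ (∃ y, (∀ q, f q = y → R q) ∧ G y (0)) ∧ (∀ p ∈ L, ∀ᶠ y in nhds (f p), (∀ q, f q = y → R q) → G y (0 + 1))))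
    (h : ¬ StepTwo) : ¬ _root_.SmoothPoincare4 := by
  intro hs
  refine h ?_
  intro M _ _ _ _ _ e _
  exact hADK M (hs M inferInstance inferInstance e)

/-- **The strongest variant of the rung is the summit.**  Same binders as `StepTwo`, genus-2
hypothesis deleted: "every smooth homotopy 4-sphere admits a genus-1 simplified broken Lefschetz
fibration" is equivalent to `SmoothPoincare4` — `→` by the route's support `RungOne`
(Hayano / Baykur–Kamada: a genus-1 SBLF homotopy sphere is `S⁴`), `←` by `hADK`. [folklore] -/
theorem strongest_iff_smoothPoincare4
    (hADK : ∀ (M : Type) [TopologicalSpace M] [T2Space M] [SecondCountableTopology M]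
      [ChartedSpace (EuclideanSpace ℝ (Fin 4)) M] [IsManifold (𝓡 4) ∞ M],
      Nonempty (M ≃ₘ⟮𝓡 4, 𝓡 4⟯ (Metric.sphere (0 : EuclideanSpace ℝ (Fin 5)) 1)) →
      (∃ (o : Literature.Topology.FourManifolds.SmoothOrientation (𝓡 4) M) (f : M → (Metric.sphere (0 : EuclideanSpace ℝ (Fin 3)) 1)) (L : Finset M), let R : M → Prop := fun q => Function.Surjective (mfderiv (𝓡 4) (𝓡 2) f q); let G : (Metric.sphere (0 : EuclideanSpace ℝ (Fin 3)) 1) → ℕ → Prop := fun y n => Nonempty ((Fin (2 * n) → ℤ) ≃ₗ[ℤ] Literature.AlgebraicTopology.SingularHomology.singularHomology ℤ ℤ ↥(f ⁻¹' {y}) 1); ContMDiff (𝓡 4) (𝓡 2) ((⊤ : ℕ∞) : WithTop ℕ∞) f ∧ Function.Surjective f ∧ (∀ p ∈ L, Literature.Topology.FourManifolds.IsLefschetzCriticalPoint (𝓡 4) (𝓡 2) o f p true) ∧ (∀ p : M, ¬ R p → p ∉ L → ∃ (φ : OpenPartialHomeomorph M (EuclideanSpace ℝ (Fin 4))) (ψ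 : OpenPartialHomeomorph (Metric.sphere (0 : EuclideanSpace ℝ (Fin 3)) 1) (EuclideanSpace ℝ (Fin 2))), p ∈ φ.source ∧ φ p = 0 ∧ Set.MapsTo f φ.source ψ.source ∧ ContMDiffOn (𝓡 4) (𝓡 4) ((⊤ : ℕ∞) : WithTop ℕ∞) φ φ.source ∧ ContMDiffOn (𝓡 4) (𝓡 4) ((⊤ : ℕ∞) : WithTop ℕ∞) φ.symm φ.target ∧ ContMDiffOn (𝓡 2) (𝓡 2) ((⊤ : ℕ∞) : WithTop ℕ∞) ψ ψ.source ∧ ContMDiffOn (𝓡 2) (𝓡 2) ((⊤ : ℕ∞) : WithTop ℕ∞) ψ.symm ψ.target ∧ ∀ q ∈ φ.source, (ψ (f q)) 0 = (φ q) 0 ∧ (ψ (f q)) 1 = (φ q) 1 ^ 2 + (φ q) 2 ^ 2 - (φ q) 3 ^ 2) ∧ IsConnected ({p : M | ¬ R p} \ (↑L : Set M)) ∧ Set.InjOn f {p : M | ¬ R p} ∧ (∀ y, (∀ q, f q = y → R q) → IsConnected (f ⁻¹' {y}) ∧ (G y (0 + 1) ∨ G y (0))) ∧ (∃ y, (∀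 q, f q = y → R q) ∧ G y (0 + 1)) ∧ (∃ y, (∀ q, f q = y → R q) ∧ G y (0)) ∧ (∀ p ∈ L, ∀ᶠ y in nhds (f p), (∀ q, f q = y → R q) → G y (0 + 1))))
    (hR : RungOne) :
    (∀ (M : Type) [TopologicalSpace M] [T2Space M] [SecondCountableTopology M]
      [ChartedSpace (EuclideanSpace ℝ (Fin 4)) M] [IsManifold (𝓡 4) ∞ M],
      M ≃ₕ (Metric.sphere (0 : EuclideanSpace ℝ (Fin 5)) 1) →
      (∃ (o : Literature.Topology.FourManifolds.SmoothOrientation (𝓡 4) M) (f : M → (Metric.sphere (0 : EuclideanSpace ℝ (Fin 3)) 1)) (L : Finset M), let R : M → Prop := fun q => Function.Surjective (mfderiv (𝓡 4) (𝓡 2) f q); let G : (Metric.sphere (0 : EuclideanSpace ℝ (Fin 3)) 1) → ℕ → Prop := fun y n => Nonempty ((Fin (2 * n) → ℤ) ≃ₗ[ℤ] Literature.AlgebraicTopology.SingularHomology.singularHomology ℤ ℤ ↥(f ⁻¹' {y}) 1); ContMDiff (𝓡 4) (𝓡 2) ((⊤ : ℕ∞) : WithTop ℕ∞) f ∧ Function.Surjective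 f ∧ (∀ p ∈ L, Literature.Topology.FourManifolds.IsLefschetzCriticalPoint (𝓡 4) (𝓡 2) o f p true) ∧ (∀ p : M, ¬ R p → p ∉ L → ∃ (φ : OpenPartialHomeomorph M (EuclideanSpace ℝ (Fin 4))) (ψ : OpenPartialHomeomorph (Metric.sphere (0 : EuclideanSpace ℝ (Fin 3)) 1) (EuclideanSpace ℝ (Fin 2))), p ∈ φ.source ∧ φ p = 0 ∧ Set.MapsTo f φ.source ψ.source ∧ ContMDiffOn (𝓡 4) (𝓡 4) ((⊤ : ℕ∞) : WithTop ℕ∞) φ φ.source ∧ ContMDiffOn (𝓡 4) (𝓡 4) ((⊤ : ℕ∞) : WithTop ℕ∞) φ.symm φ.target ∧ ContMDiffOn (𝓡 2) (𝓡 2) ((⊤ : ℕ∞) : WithTop ℕ∞) ψ ψ.source ∧ ContMDiffOn (𝓡 2) (𝓡 2) ((⊤ : ℕ∞) : WithTop ℕ∞) ψ.symm ψ.target ∧ ∀ q ∈ φ.source, (ψ (f q)) 0 = (φ q) 0 ∧ (ψ (f q)) 1 = (φ q) 1 ^ 2 + (φ q) 2 ^ 2 - (φ q) 3 ^ 2)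 ∧ IsConnected ({p : M | ¬ R p} \ (↑L : Set M)) ∧ Set.InjOn f {p : M | ¬ R p} ∧ (∀ y, (∀ q, f q = y → R q) → IsConnected (f ⁻¹' {y}) ∧ (G y (0 + 1) ∨ G y (0))) ∧ (∃ y, (∀ q, f q = y → R q) ∧ G y (0 + 1)) ∧ (∃ y, (∀ q, f q = y → R q) ∧ G y (0)) ∧ (∀ p ∈ L, ∀ᶠ y in nhds (f p), (∀ q, f q = y → R q) → G y (0 + 1)))) ↔
      _root_.SmoothPoincare4 := by
  constructor
  · intro h M _ _ _ _ _ e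
    exact hR M e (h M e)
  · intro hs M _ _ _ _ _ e
    exact hADK M (hs M inferInstance inferInstance e)

/-- **Sandwich.**  `¬ StepTwo` refutes the strongest variant as well (the variant implies the rung
trivially); with `strongest_iff_smoothPoincare4` every intermediate mutation of the genus-2
hypothesis is refutable only by an exotic 4-sphere. [folklore] -/
theorem not_strongest_of_not_stepTwo (h : ¬ StepTwo) :
    ¬ (∀ (M : Type) [TopologicalSpace M] [T2Space M] [SecondCountableTopology M]
      [ChartedSpace (EuclideanSpace ℝ (Fin 4)) M] [IsManifold (𝓡 4) ∞ M],
      M ≃ₕ (Metric.sphere (0 : EuclideanSpace ℝ (Fin 5)) 1) →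
      (∃ (o : Literature.Topology.FourManifolds.SmoothOrientation (𝓡 4) M) (f : M → (Metric.sphere (0 : EuclideanSpace ℝ (Fin 3)) 1)) (L : Finset M), let R : M → Prop := fun q => Function.Surjective (mfderiv (𝓡 4) (𝓡 2) f q); let G : (Metric.sphere (0 : EuclideanSpace ℝ (Fin 3)) 1) → ℕ → Prop := fun y n => Nonempty ((Fin (2 * n) → ℤ) ≃ₗ[ℤ] Literature.AlgebraicTopology.SingularHomology.singularHomology ℤ ℤ ↥(f ⁻¹' {y}) 1); ContMDiff (𝓡 4) (𝓡 2) ((⊤ : ℕ∞) : WithTop ℕ∞) f ∧ Function.Surjective f ∧ (∀ p ∈ L, Literature.Topology.FourManifolds.IsLefschetzCriticalPoint (𝓡 4) (𝓡 2) o f p true) ∧ (∀ p : M, ¬ R p → p ∉ L → ∃ (φ : OpenPartialHomeomorph M (EuclideanSpace ℝ (Fin 4))) (ψ : OpenPartialHomeomorph (Metric.sphere (0 : EuclideanSpace ℝ (Fin 3)) 1) (EuclideanSpace ℝ (Fin 2))), p ∈ φ.source ∧ φ p = 0 ∧ Set.MapsTo f φ.source ψ.source ∧ ContMDiffOn (𝓡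 4) (𝓡 4) ((⊤ : ℕ∞) : WithTop ℕ∞) φ φ.source ∧ ContMDiffOn (𝓡 4) (𝓡 4) ((⊤ : ℕ∞) : WithTop ℕ∞) φ.symm φ.target ∧ ContMDiffOn (𝓡 2) (𝓡 2) ((⊤ : ℕ∞) : WithTop ℕ∞) ψ ψ.source ∧ ContMDiffOn (𝓡 2) (𝓡 2) ((⊤ : ℕ∞) : WithTop ℕ∞) ψ.symm ψ.target ∧ ∀ q ∈ φ.source, (ψ (f q)) 0 = (φ q) 0 ∧ (ψ (f q)) 1 = (φ q) 1 ^ 2 + (φ q) 2 ^ 2 - (φ q) 3 ^ 2) ∧ IsConnected ({p : M | ¬ R p} \ (↑L : Set M)) ∧ Set.InjOn f {p : M | ¬ R p} ∧ (∀ y, (∀ q, f q = y → R q) → IsConnected (f ⁻¹' {y}) ∧ (G y (0 + 1) ∨ G y (0))) ∧ (∃ y, (∀ q, f q = y → R q) ∧ G y (0 + 1)) ∧ (∃ y, (∀ q, f q = y → R q) ∧ G y (0)) ∧ (∀ p ∈ L, ∀ᶠ y in nhds (f p), (∀ q, f q = y → R q) → G y (0 + 1)))) := by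
  intro hs
  refine h ?_
  intro M _ _ _ _ _ e _
  exact hs M e

end Summit.SmoothPoincare4.SmoothPoincare4.Theorems.StepTwo.Negative

end
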